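import Literature.Probability.LatticeModels.CurrentSwitching
import Literature.Probability.LatticeModels.ModifiedSimonInequality
import HarnessLib

/-!
# Random currents with edge-dependent couplings: definitions

Topic `Literature/Probability/LatticeModels`, namespace `Literature.Probability.LatticeModels`
(dot-notation extensions in `….Current`). The tree's random-current representation
(`RandomCurrents.lean`, `RandomCurrentsProofs.lean`, `CurrentSwitching.lean`) is written for a **uniform**
coupling `β` on the edges of a finite simple graph `G` (weight `w_β(n) = ∏_e β^{n_e}/n_e!`). Long-range /
inhomogeneous ferromagnetic pair interactions `J_{x,y} ≥ 0` (Panis 2023, §4: "`w_β(n) := ∏_{{x,y}⊂Λ}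
(βJ_{x,y})^{n_{x,y}}/n_{x,y}!`") need edge-dependent couplings `K : E(G) → ℝ`. This file introduces the
weighted objects, keeping the tree's *combinatorial* type of currents `Current G = (E(G) → ℕ)` (so that
degrees, sources, traces, `binom`, `IsSupp`, `switchCount`, `connIn`, the parity lemmas and the
character-expansion identity `Current.switchCount_symmDiff` are reused verbatim):

* `Current.wweight K n = ∏_e K_e^{n_e}/n_e!` (real) and `Current.eweight K n` (its `ℝ≥0∞` cast, the form in
  which all current sums below are manipulated — unconditional Fubini/reindexing);
* `wcurrentSum K A = ∑_{∂n = A} w_K(n)` (real, for the Ising dictionary), `ecurrentSum K A` (`ℝ≥0∞`), and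
  `ecurrentSumIn G₁ K A` — the same sum over currents supported on the edges of a second graph `G₁`
  (`Current.IsSupp G₁`), i.e. the current sum *of the subgraph* `G₁ ∩ G` with the induced couplings;
* `offGraph G S` — `G` with every edge meeting the vertex set `S` deleted (same vertex type), the graph
  "`Λ ∖ S`" of the restricted state `⟨·⟩_{Λ∖S}`; `Current.spliceOff S a b` — the current equal to `b` on the
  edges off `S` and to `a` elsewhere (the weight-preserving involution behind conditioning on a cluster);
  `Current.cluster n x` — the cluster `C_n(x)` as a `Finset`;
* `pairEdgeWeight J β` — the couplings `K_{{a,b}} = β (J_{a,b} + J_{b,a})/2` on the complete graph induced by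
  a pair interaction `J` (`= βJ_{a,b}` for symmetric `J`), the dictionary to `-βH = (β/2)∑_{x,y} J_{x,y}σ_xσ_y`.

Only definitions and their immediate API are here; the weighted switching lemma, the Ising dictionary and the
tree diagram bound are in the sibling proof files `WeightedCurrentsSwitching.lean`, `WeightedTreeBound*.lean`.

## References

* R. Panis, arXiv:2309.05797 (2023) = Ann. Probab. 54 (2026), §4.1 (Definition 4.1, Lemma 4.4)
  [Panis2023Triviality] (held; read pp. 19–20).
* H. Duminil-Copin, arXiv:1607.06933 (2016), §2 [DuminilCopin2016]; M. Aizenman, Comm. Math. Phys. 86 (1982)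
  [Aizenman1982] — as in the tree's `RandomCurrents.lean`.
-/

noncomputable section

open Finset
open scoped symmDiff ENNReal

namespace Literature.Probability.LatticeModels

variable {V : Type*} [Fintype V] {G : SimpleGraph V} [DecidableRel G.Adj]

namespace Current

/-! ### Weighted weights -/

/-- The weight of a current for edge-dependent couplings `K`,
`w_K(n) = ∏_e K_e^{n_e} / n_e!` (Panis 2023, Definition 4.1: `w_β(n) = ∏ (βJ_{x,y})^{n_{x,y}}/n_{x,y}!`,
i.e. `K_{{x,y}} = βJ_{x,y}`). [cite: Panis2023Triviality, Definition 4.1] -/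
def wweight (K : G.edgeFinset → ℝ) (n : Current G) : ℝ :=
  ∏ e, K e ^ (n e) / ((n e).factorial : ℝ)

/-- The tree's uniform weight is the weighted weight of the constant coupling. [folklore] -/
theorem weight_eq_wweight (β : ℝ) (n : Current G) : n.weight β = n.wweight (fun _ => β) := rfl

/-- `w_K(n) ≥ 0` for `K ≥ 0`. [cite: Panis2023Triviality, Definition 4.1] -/
theorem wweight_nonneg {K : G.edgeFinset → ℝ} (hK : ∀ e, 0 ≤ K e) (n : Current G) : 0 ≤ n.wweight K :=
  prod_nonneg fun e _ => div_nonneg (pow_nonneg (hK e) _) (Nat.cast_nonneg _)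

/-- The zero current has weight `1`. [folklore] -/
@[simp] theorem wweight_zero (K : G.edgeFinset → ℝ) : (0 : Current G).wweight K = 1 := by
  simp [wweight]

/-- The weight in `ℝ≥0∞`: `eweight K n = ENNReal.ofReal (w_K(n))` (meaningful for `K ≥ 0`). [folklore] -/
def eweight (K : G.edgeFinset → ℝ) (n : Current G) : ℝ≥0∞ := ENNReal.ofReal (n.wweight K)

/-- `eweight` is finite. [folklore] -/
@[simp] theorem eweight_ne_top (K : G.edgeFinset → ℝ) (n : Current G) : n.eweight K ≠ ∞ :=
  ENNReal.ofReal_ne_top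

/-- `eweight K 0 = 1`. [folklore] -/
@[simp] theorem eweight_zero (K : G.edgeFinset → ℝ) : (0 : Current G).eweight K = 1 := by
  simp [eweight]

/-- `(eweight K n).toReal = w_K(n)` for `K ≥ 0`. [folklore] -/
theorem toReal_eweight {K : G.edgeFinset → ℝ} (hK : ∀ e, 0 ≤ K e) (n : Current G) :
    (n.eweight K).toReal = n.wweight K :=
  ENNReal.toReal_ofReal (wweight_nonneg hK n)

/-! ### Clusters as finite sets -/

open Classical in
/-- The cluster `C_n(x) = {v | x ⟷ v in the trace of n}` of a vertex, as a `Finset`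
(Panis 2023, Definition 4.3 (ii)). [cite: Panis2023Triviality, Definition 4.3] -/
def cluster (n : Current G) (x : V) : Finset V :=
  univ.filter fun v => (Percolation.openGraph n.traced).Reachable x v

/-- Membership in the cluster. [cite: Panis2023Triviality, Definition 4.3] -/
theorem mem_cluster_iff {n : Current G} {x v : V} :
    v ∈ n.cluster x ↔ (Percolation.openGraph n.traced).Reachable x v := by
  classical
  simp [cluster]

/-- `x ∈ C_n(x)`. [folklore] -/
@[simp] theorem mem_cluster_self (n : Current G) (x : V) : x ∈ n.cluster x :=
  mem_cluster_iff.2 (SimpleGraph.Reachable.refl x)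

/-! ### Splicing two currents along a vertex set -/

/-- An unordered pair lies *off* `S` when both its endpoints are outside `S`. [folklore] -/
def EdgeOff (S : Finset V) (e : Sym2 V) : Prop := ∀ v ∈ e, v ∉ S

omit [Fintype V] [DecidableRel G.Adj] in
/-- `EdgeOff` on a concrete pair. [folklore] -/
@[simp] theorem edgeOff_mk {S : Finset V} {a b : V} : EdgeOff S s(a, b) ↔ a ∉ S ∧ b ∉ S := by
  simp [EdgeOff]

omit [DecidableRel G.Adj] in
/-- `EdgeOff S e` is decidable (a bounded quantifier over the finite vertex type). [folklore] -/
instance instDecidableEdgeOff [DecidableEq V] (S : Finset V) (e : Sym2 V) : Decidable (EdgeOff S e) := by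
  unfold EdgeOff; infer_instance

section Splice

variable [DecidableEq V]

/-- **Splicing**: `spliceOff S a b` is the current equal to `b` on the edges off `S` and to `a` on the
edges meeting `S` (the change of variables behind conditioning on the cluster `C(x) = S`: the second
current keeps its part inside the cluster and trades its part outside). [folklore] -/
def spliceOff (S : Finset V) (a b : Current G) : Current G := fun e =>
  if EdgeOff S (e : Sym2 V) then b e else a e

/-- `spliceOff` on an edge off `S`. [folklore] -/
theorem spliceOff_apply_of_edgeOff {S : Finset V} (a b : Current G) {e : G.edgeFinset}
    (he : EdgeOff S (e : Sym2 V)) : spliceOff S a b e = b e := if_pos he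

/-- `spliceOff` on an edge meeting `S`. [folklore] -/
theorem spliceOff_apply_of_not_edgeOff {S : Finset V} (a b : Current G) {e : G.edgeFinset}
    (he : ¬ EdgeOff S (e : Sym2 V)) : spliceOff S a b e = a e := if_neg he

/-- Splicing twice with the roles exchanged returns the original current. [folklore] -/
@[simp] theorem spliceOff_spliceOff (S : Finset V) (a b : Current G) :
    spliceOff S (spliceOff S a b) (spliceOff S b a) = a := by
  funext e
  by_cases he : EdgeOff S (e : Sym2 V) <;> simp [spliceOff, he]

/-- `spliceOff S a a = a`. [folklore] -/
@[simp] theorem spliceOff_self (S : Finset V) (a : Current G) : spliceOff S a a = a := by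
  funext e
  by_cases he : EdgeOff S (e : Sym2 V) <;> simp [spliceOff, he]

/-- **Splicing preserves the product of the weights** (edge by edge the two values are kept or
exchanged): `w_K(spliceOff S a b) · w_K(spliceOff S b a) = w_K(a) · w_K(b)`. [folklore] -/
theorem wweight_spliceOff_mul_wweight_spliceOff (K : G.edgeFinset → ℝ) (S : Finset V) (a b : Current G) :
    (spliceOff S a b).wweight K * (spliceOff S b a).wweight K = a.wweight K * b.wweight K := by
  unfold wweight
  rw [← prod_mul_distrib, ← prod_mul_distrib]
  refine prod_congr rfl fun e _ => ?_
  by_cases he : EdgeOff S (e : Sym2 V)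
  · simp only [spliceOff, he, if_true, mul_comm]
  · simp only [spliceOff, he, if_false]

/-- The same for the `ℝ≥0∞` weights (`K ≥ 0`). [folklore] -/
theorem eweight_spliceOff_mul_eweight_spliceOff {K : G.edgeFinset → ℝ} (hK : ∀ e, 0 ≤ K e) (S : Finset V)
    (a b : Current G) :
    (spliceOff S a b).eweight K * (spliceOff S b a).eweight K = a.eweight K * b.eweight K := by
  simp only [eweight, ← ENNReal.ofReal_mul (wweight_nonneg hK _)]
  rw [wweight_spliceOff_mul_wweight_spliceOff]

end Splice

end Current

/-! ### The graph off a vertex set -/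

/-- `offGraph G S`: the graph `G` with every edge meeting `S` removed (the vertices of `S` become
isolated; same vertex type), i.e. the interaction graph of the restricted state `⟨·⟩_{Λ ∖ S}`. [folklore] -/
def offGraph (G : SimpleGraph V) (S : Finset V) : SimpleGraph V where
  Adj a b := G.Adj a b ∧ a ∉ S ∧ b ∉ S
  symm := ⟨fun _ _ h => ⟨h.1.symm, h.2.2, h.2.1⟩⟩
  loopless := ⟨fun a h => G.loopless.irrefl a h.1⟩

omit [Fintype V] [DecidableRel G.Adj] in
/-- Adjacency in `offGraph`. [folklore] -/
@[simp] theorem offGraph_adj {S : Finset V} {a b : V} :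
    (offGraph G S).Adj a b ↔ G.Adj a b ∧ a ∉ S ∧ b ∉ S := Iff.rfl

omit [Fintype V] in
/-- Adjacency in `offGraph` is decidable. [folklore] -/
instance instDecidableRelOffGraphAdj [DecidableEq V] (S : Finset V) : DecidableRel (offGraph G S).Adj :=
  fun a b => decidable_of_iff (G.Adj a b ∧ a ∉ S ∧ b ∉ S) offGraph_adj.symm

omit [Fintype V] [DecidableRel G.Adj] in
/-- `offGraph G S ≤ G`. [folklore] -/
theorem offGraph_le (S : Finset V) : offGraph G S ≤ G := fun _ _ h => h.1

omit [Fintype V] [DecidableRel G.Adj] in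
/-- The edges of `offGraph G S` are the edges of `G` off `S`. [folklore] -/
theorem mem_edgeSet_offGraph {S : Finset V} {e : Sym2 V} :
    e ∈ (offGraph G S).edgeSet ↔ e ∈ G.edgeSet ∧ Current.EdgeOff S e := by
  induction e using Sym2.ind with
  | _ a b => simp [SimpleGraph.mem_edgeSet]

section Sums

variable [DecidableEq V]

/-- The edge finset of `offGraph G S`. [folklore] -/
theorem mem_edgeFinset_offGraph {S : Finset V} {e : Sym2 V} :
    e ∈ (offGraph G S).edgeFinset ↔ e ∈ G.edgeFinset ∧ Current.EdgeOff S e := by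
  rw [SimpleGraph.mem_edgeFinset, SimpleGraph.mem_edgeFinset, mem_edgeSet_offGraph]

/-- A current of `G` is supported on `offGraph G S` iff it vanishes on every edge meeting `S`. [folklore] -/
theorem isSupp_offGraph_iff {S : Finset V} {n : Current G} :
    Current.IsSupp (offGraph G S) n ↔ ∀ e : G.edgeFinset, ¬ Current.EdgeOff S (e : Sym2 V) → n e = 0 := by
  refine ⟨fun h e he => h e fun hm => he (mem_edgeFinset_offGraph.1 hm).2, fun h e he => h e fun ho => he ?_⟩
  exact mem_edgeFinset_offGraph.2 ⟨e.2, ho⟩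

omit [DecidableEq V] in
/-- Every current is supported on the whole graph. [folklore] -/
theorem Current.isSupp_self (n : Current G) : Current.IsSupp G n := fun e he => absurd e.2 he

/-! ### Weighted current sums -/

/-- The weighted current sum with prescribed sources, `Z_K[A] = ∑_{∂n = A} w_K(n)` (real; a `tsum` over
the countably many currents, absolutely convergent — `WeightedCurrentsSwitching`). This is the numerator of
the random-current representation `⟨σ_A⟩ = Z_K[A]/Z_K[∅]` (Panis 2023, §4.1, display after Definition 4.1).
[cite: Panis2023Triviality, §4.1] -/
def wcurrentSum (K : G.edgeFinset → ℝ) (A : Finset V) : ℝ :=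
  ∑' n : Current G, if n.sources = A then n.wweight K else 0

/-- `Z_K[A]` in `ℝ≥0∞`. [cite: Panis2023Triviality, §4.1] -/
def ecurrentSum (K : G.edgeFinset → ℝ) (A : Finset V) : ℝ≥0∞ :=
  ∑' n : Current G, if n.sources = A then n.eweight K else 0

/-- The weighted current sum of the currents of `G` supported on the edges of `G₁`,
`Z_{G₁,K}[A] = ∑_{n ⊆ E(G₁), ∂n = A} w_K(n)` (`ℝ≥0∞`): the current sum of the subgraph `G₁ ∩ G` with the
induced couplings (for `G₁ = offGraph G S`, that of the restricted state `⟨·⟩_{Λ∖S}`). [folklore] -/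
def ecurrentSumIn (G₁ : SimpleGraph V) [DecidableRel G₁.Adj] (K : G.edgeFinset → ℝ) (A : Finset V) : ℝ≥0∞ :=
  ∑' n : Current G, if Current.IsSupp G₁ n ∧ n.sources = A then n.eweight K else 0

/-- On the whole graph the supported sum is the plain sum. [folklore] -/
theorem ecurrentSumIn_self (K : G.edgeFinset → ℝ) (A : Finset V) : ecurrentSumIn G K A = ecurrentSum K A := by
  unfold ecurrentSumIn ecurrentSum
  refine tsum_congr fun n => ?_
  simp [Current.isSupp_self n]

/-- The zero current alone gives `1 ≤ Z_{G₁,K}[∅]`. [folklore] -/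
theorem one_le_ecurrentSumIn_empty (G₁ : SimpleGraph V) [DecidableRel G₁.Adj] (K : G.edgeFinset → ℝ) :
    1 ≤ ecurrentSumIn G₁ K ∅ := by
  unfold ecurrentSumIn
  refine le_trans (le_of_eq ?_) (ENNReal.le_tsum (0 : Current G))
  rw [if_pos ⟨Current.isSupp_zero G₁, Current.sources_zero⟩, Current.eweight_zero]

/-- `1 ≤ Z_K[∅]`. [folklore] -/
theorem one_le_ecurrentSum_empty (K : G.edgeFinset → ℝ) : 1 ≤ ecurrentSum K (∅ : Finset V) := by
  rw [← ecurrentSumIn_self]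
  exact one_le_ecurrentSumIn_empty G K

/-- `Z_K[∅] ≠ 0`. [folklore] -/
theorem ecurrentSum_empty_ne_zero (K : G.edgeFinset → ℝ) : ecurrentSum K (∅ : Finset V) ≠ 0 :=
  (lt_of_lt_of_le zero_lt_one (one_le_ecurrentSum_empty K)).ne'

/-- Supported sums are dominated by the plain sums: `Z_{G₁,K}[A] ≤ Z_K[A]`. [folklore] -/
theorem ecurrentSumIn_le (G₁ : SimpleGraph V) [DecidableRel G₁.Adj] (K : G.edgeFinset → ℝ) (A : Finset V) :
    ecurrentSumIn G₁ K A ≤ ecurrentSum K A := by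
  unfold ecurrentSumIn ecurrentSum
  refine ENNReal.tsum_le_tsum fun n => ?_
  by_cases h : Current.IsSupp G₁ n ∧ n.sources = A
  · rw [if_pos h, if_pos h.2]
  · rw [if_neg h]; exact bot_le

/-- The `ℝ≥0∞` weight of a pair of currents with prescribed sources,
`1{∂n₁ = A} 1{∂n₂ = B} w_K(n₁) w_K(n₂)` (weighted form of the tree's `pairWeight`).
[cite: DuminilCopin2016, §2.2] -/
def epairWeight (K : G.edgeFinset → ℝ) (A B : Finset V) (p : Current G × Current G) : ℝ≥0∞ :=
  if p.1.sources = A ∧ p.2.sources = B then p.1.eweight K * p.2.eweight K else 0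

/-- The pair weight is the product of the two indicator-restricted weights. [folklore] -/
theorem epairWeight_eq_mul (K : G.edgeFinset → ℝ) (A B : Finset V) (p : Current G × Current G) :
    epairWeight K A B p =
      (if p.1.sources = A then p.1.eweight K else 0) * (if p.2.sources = B then p.2.eweight K else 0) := by
  unfold epairWeight
  by_cases h1 : p.1.sources = A <;> by_cases h2 : p.2.sources = B <;> simp [h1, h2]

/-- `∑_{(n₁,n₂)} 1{∂n₁ = A}1{∂n₂ = B} w w = Z_K[A] · Z_K[B]` (Fubini in `ℝ≥0∞`, the tree's
`tsum_mul_tsum_eq_tsum_prod` of `ModifiedSimonInequality.lean`). [cite: DuminilCopin2016, §2.2] -/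
theorem tsum_epairWeight (K : G.edgeFinset → ℝ) (A B : Finset V) :
    ∑' p, epairWeight K A B p = ecurrentSum K A * ecurrentSum K B := by
  unfold ecurrentSum
  rw [tsum_mul_tsum_eq_tsum_prod]
  exact tsum_congr fun p => epairWeight_eq_mul K A B p

/-! ### Couplings induced by a pair interaction -/

/-- The couplings on the complete graph induced by a pair interaction `J` at inverse temperature `β`:
`K_{{a,b}} = β (J_{a,b} + J_{b,a}) / 2` (`= β J_{a,b}` for symmetric `J`), so that
`(β/2) ∑_{a,b} J_{a,b} σ_aσ_b = (β/2)∑_a J_{a,a} + ∑_{e} K_e σ_e` (Panis 2023, §4.1: `w_β(n) = ∏(βJ_{x,y})^{n}/n!`).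
[cite: Panis2023Triviality, Definition 4.1] -/
def pairEdgeWeight (J : V → V → ℝ) (β : ℝ) (e : (⊤ : SimpleGraph V).edgeFinset) : ℝ :=
  Sym2.lift ⟨fun a b => β / 2 * (J a b + J b a), fun a b => by ring⟩ (e : Sym2 V)

/-- `pairEdgeWeight` on a concrete edge. [folklore] -/
theorem pairEdgeWeight_apply_mk (J : V → V → ℝ) (β : ℝ) {a b : V} (h : s(a, b) ∈ (⊤ : SimpleGraph V).edgeFinset) :
    pairEdgeWeight J β ⟨s(a, b), h⟩ = β / 2 * (J a b + J b a) := rfl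

/-- `pairEdgeWeight J β ≥ 0` for `β ≥ 0`, `J ≥ 0`. [folklore] -/
theorem pairEdgeWeight_nonneg {J : V → V → ℝ} {β : ℝ} (hβ : 0 ≤ β) (hJ : ∀ a b, 0 ≤ J a b)
    (e : (⊤ : SimpleGraph V).edgeFinset) : 0 ≤ pairEdgeWeight J β e := by
  obtain ⟨e, he⟩ := e
  induction e using Sym2.ind with
  | _ a b =>
    rw [pairEdgeWeight_apply_mk]
    exact mul_nonneg (by positivity) (add_nonneg (hJ a b) (hJ b a))

end Sums

end Literature.Probability.LatticeModels

end
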